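import Mathlib
import Summits.Ventures.PercRepro2.Defs
import Summits.Ventures.PercRepro2.Independence
import Summits.Ventures.PercRepro2.Harris
import Summits.Ventures.PercRepro2.Graph
import Summits.Ventures.PercRepro2.Exploration
import Summits.Ventures.PercRepro2.Events
import Summits.Ventures.PercRepro2.FourFunctions
import Summits.Ventures.PercRepro2.Induced
import Summits.Ventures.PercRepro2.Frontier
import Summits.Ventures.PercRepro2.ObsIndependence
import Summits.Ventures.PercRepro2.BHK
import Summits.Ventures.PercRepro2.BHKEvents
import Summits.Ventures.PercRepro2.VdBKahn
import Summits.Ventures.PercRepro2.BHKAvoid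
import Summits.Ventures.PercRepro2.R2PrimeThreeReduction
import Summits.Ventures.PercRepro2.YBridge
import Summits.Ventures.PercRepro2.Yu1Functionals
import Summits.Ventures.PercRepro2.Yu1Events
import Summits.Ventures.PercRepro2.Yu1
import Summits.Ventures.PercRepro2.LBSplit
import Summits.Ventures.PercRepro2.YDelta
import Summits.Ventures.PercRepro2.SD
import Summits.Ventures.PercRepro2.Threshold
import Summits.Ventures.PercRepro2.Lambda
import Summits.Ventures.PercRepro2.LambdaTau
import Summits.Ventures.PercRepro2.LambdaSlack
import Summits.Ventures.PercRepro2.HF2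
import Summits.Ventures.PercRepro2.Yu2
import Summits.Ventures.PercRepro2.N0
import Summits.Ventures.PercRepro2.Y
import Summits.Ventures.PercRepro2.YDeltaTools
import Summits.Ventures.PercRepro2.ZDelta
import Summits.Ventures.PercRepro2.ZExpand

/-!
# The (I)/(IIp) split of the crux (blind cell PercRepro2, typer-1; lead g7 ADDENDUM 17 (14))

Atoms on `Q`: `R = {a₂, a₃ ∉ C₁}`, `PD`, `T`, the `o`-locations `oL = {o ∈ C₁}`, `oH = {o ∈ C₂}`,
`out = oLᶜ ∩ oHᶜ`, `D = P(PD)`, `D_l, D_h, D_out`, `M_l = P(PD, bL)`, the `R`-margins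
`M_R = P(R, bH) − P(R, bL)` and `M_R^{oL}`; the pieces

* `MRl = M_R D_l − D M_R^{oL}` (THEOREM MRl ≥ 0, the lead's `MRl.lean`), `AL`, `AH`, `ASSOC = AL + AH`
  (`ASSOC_eq`), `LH`, `PieceI = MRl − AL`, `PieceIIcore = M_R D_h + D Δ_h`, `PieceII = PieceIIcore − AH`,
  `MRshare = MRl + M_R D_h`;
* **identities** (all ring identities over the `R = PD ⊔ T` and `o`-location splits):
  `sigma_eq_MRl` — `(Yu1Δ)-slack = MRl + D_l M_l − D P(PD, oL, bL)`; `PieceI_eq` — `(I) = (Yu1Δ)-slack + LH`;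
  `Yh_sub_LH_eq` — `Yh − LH = M_R D_h − AH`; **`Z_eq_I_add_II`** — `Z = (I) + (IIp)`;
  `Z0Zh_eq_MRshare_sub_ASSOC` — `L2 = MRshare − ASSOC`.
* rows `PieceINonneg` ((I) ≥ 0), `PieceIINonneg` ((IIp) ≥ 0), `PieceIIcoreNonneg`, `LHNonneg` (census-true
  at n ≤ 7, ADDENDUM 17 (14)(j)); `ZDelta_of_pieces`.
-/

namespace Summit.Ventures.PercRepro2

open UnionCluster Yu1

namespace ISplit

section Atoms

variable {V : Type*} {E : Type*} [Fintype E] [DecidableEq E] [DecidableEq V] {R : Type*} [Field R]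

/-- `D_out = P(PD, o ∉ C₁ ∪ C₂)`. -/
noncomputable def Dout (p : E → R) (ends : E → Sym2 V) (o a₁ a₂ a₃ : V) : R :=
  prob p (PDEvent ends a₁ a₂ a₃ ∩ (connEvent ends a₁ o)ᶜ ∩ (connEvent ends a₂ o)ᶜ)

/-- `M_R = P(R, b ∈ C₂) − P(R, b ∈ C₁)`. -/
noncomputable def MR (p : E → R) (ends : E → Sym2 V) (a₁ a₂ a₃ b : V) : R :=
  prob p (connEvent ends a₂ b ∩ avoidAll ends a₁ {a₂, a₃}) -
    prob p (connEvent ends a₁ b ∩ avoidAll ends a₁ {a₂, a₃})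

/-- `M_R^{oL} = P(R, o ∈ C₁, b ∈ C₂) − P(R, o ∈ C₁, b ∈ C₁)`. -/
noncomputable def MRoL (p : E → R) (ends : E → Sym2 V) (o a₁ a₂ a₃ b : V) : R :=
  prob p (connEvent ends a₁ o ∩ connEvent ends a₂ b ∩ avoidAll ends a₁ {a₂, a₃}) -
    prob p (connEvent ends a₁ o ∩ connEvent ends a₁ b ∩ avoidAll ends a₁ {a₂, a₃})

/-- `MRl = M_R · D_l − D · M_R^{oL}` ("the `oL`-share of the `R`-margin is at most `g_l`"). -/
noncomputable def MRl (p : E → R) (ends : E → Sym2 V) (o a₁ a₂ a₃ b : V) : R :=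
  MR p ends a₁ a₂ a₃ b * prob p (PDEvent ends a₁ a₂ a₃ ∩ connEvent ends a₁ o) -
    prob p (PDEvent ends a₁ a₂ a₃) * MRoL p ends o a₁ a₂ a₃ b

/-- `AL = D_out · P(PD, bL, oL) − D_l · P(PD, bL, out)`. -/
noncomputable def AL (p : E → R) (ends : E → Sym2 V) (o a₁ a₂ a₃ b : V) : R :=
  Dout p ends o a₁ a₂ a₃ *
      prob p (PDEvent ends a₁ a₂ a₃ ∩ connEvent ends a₁ o ∩ connEvent ends a₁ b) -
    prob p (PDEvent ends a₁ a₂ a₃ ∩ connEvent ends a₁ o) *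
      prob p (PDEvent ends a₁ a₂ a₃ ∩ (connEvent ends a₁ o)ᶜ ∩ (connEvent ends a₂ o)ᶜ ∩
        connEvent ends a₁ b)

/-- `AH = D_out · P(PD, bL, oH) − D_h · P(PD, bL, out)`. -/
noncomputable def AH (p : E → R) (ends : E → Sym2 V) (o a₁ a₂ a₃ b : V) : R :=
  Dout p ends o a₁ a₂ a₃ *
      prob p (PDEvent ends a₁ a₂ a₃ ∩ connEvent ends a₂ o ∩ connEvent ends a₁ b) -
    prob p (PDEvent ends a₁ a₂ a₃ ∩ connEvent ends a₂ o) *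
      prob p (PDEvent ends a₁ a₂ a₃ ∩ (connEvent ends a₁ o)ᶜ ∩ (connEvent ends a₂ o)ᶜ ∩
        connEvent ends a₁ b)

/-- `ASSOC = M_l · D_out − D · P(PD, bL, out)`. -/
noncomputable def ASSOC (p : E → R) (ends : E → Sym2 V) (o a₁ a₂ a₃ b : V) : R :=
  prob p (PDEvent ends a₁ a₂ a₃ ∩ connEvent ends a₁ b) * Dout p ends o a₁ a₂ a₃ -
    prob p (PDEvent ends a₁ a₂ a₃) *
      prob p (PDEvent ends a₁ a₂ a₃ ∩ (connEvent ends a₁ o)ᶜ ∩ (connEvent ends a₂ o)ᶜ ∩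
        connEvent ends a₁ b)

/-- `LH = D_h · P(PD, bL, oL) − D_l · P(PD, bL, oH)`. -/
noncomputable def LH (p : E → R) (ends : E → Sym2 V) (o a₁ a₂ a₃ b : V) : R :=
  prob p (PDEvent ends a₁ a₂ a₃ ∩ connEvent ends a₂ o) *
      prob p (PDEvent ends a₁ a₂ a₃ ∩ connEvent ends a₁ o ∩ connEvent ends a₁ b) -
    prob p (PDEvent ends a₁ a₂ a₃ ∩ connEvent ends a₁ o) *
      prob p (PDEvent ends a₁ a₂ a₃ ∩ connEvent ends a₂ o ∩ connEvent ends a₁ b)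

/-- `(I) = MRl − AL`. -/
noncomputable def PieceI (p : E → R) (ends : E → Sym2 V) (o a₁ a₂ a₃ b : V) : R :=
  MRl p ends o a₁ a₂ a₃ b - AL p ends o a₁ a₂ a₃ b

/-- `(IIp-core) = M_R · D_h + D · Δ_h`. -/
noncomputable def PieceIIcore (p : E → R) (ends : E → Sym2 V) (o a₁ a₂ a₃ b : V) : R :=
  MR p ends a₁ a₂ a₃ b * prob p (PDEvent ends a₁ a₂ a₃ ∩ connEvent ends a₂ o) +
    prob p (PDEvent ends a₁ a₂ a₃) * deltaH p ends o a₁ a₂ a₃ b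

/-- `(IIp) = (IIp-core) − AH`. -/
noncomputable def PieceII (p : E → R) (ends : E → Sym2 V) (o a₁ a₂ a₃ b : V) : R :=
  PieceIIcore p ends o a₁ a₂ a₃ b - AH p ends o a₁ a₂ a₃ b

/-- `MRshare = MRl + M_R · D_h` (`= M_R · D_o − D · M_R^{oL}`). -/
noncomputable def MRshare (p : E → R) (ends : E → Sym2 V) (o a₁ a₂ a₃ b : V) : R :=
  MRl p ends o a₁ a₂ a₃ b + MR p ends a₁ a₂ a₃ b * prob p (PDEvent ends a₁ a₂ a₃ ∩ connEvent ends a₂ o)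

end Atoms

section Rows

variable {V : Type*} {E : Type*} [Fintype E] [DecidableEq E] [DecidableEq V] {R : Type*} [Field R]
  [LinearOrder R]

/-- Row `(I) ≥ 0` (ADDENDUM 17 (14), n ≤ 7: 0 / 44.9M). -/
def PieceINonneg (p : E → R) (ends : E → Sym2 V) (o a₁ a₂ a₃ b : V) : Prop :=
  0 ≤ PieceI p ends o a₁ a₂ a₃ b

/-- Row `(IIp) ≥ 0`. -/
def PieceIINonneg (p : E → R) (ends : E → Sym2 V) (o a₁ a₂ a₃ b : V) : Prop :=
  0 ≤ PieceII p ends o a₁ a₂ a₃ b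

/-- Row `(IIp-core) ≥ 0`. -/
def PieceIIcoreNonneg (p : E → R) (ends : E → Sym2 V) (o a₁ a₂ a₃ b : V) : Prop :=
  0 ≤ PieceIIcore p ends o a₁ a₂ a₃ b

/-- Row `LH ≥ 0`: `P(bL | PD, oL) ≥ P(bL | PD, oH)`. -/
def LHNonneg (p : E → R) (ends : E → Sym2 V) (o a₁ a₂ a₃ b : V) : Prop :=
  0 ≤ LH p ends o a₁ a₂ a₃ b

end Rows

section Splits

variable {V : Type*} {E : Type*} [Fintype E] [DecidableEq E] [Fintype V] [DecidableEq V]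
  {R : Type*} [Field R] [LinearOrder R] [IsStrictOrderedRing R]

omit [Fintype E] [DecidableEq E] [Fintype V] in
/-- `PD = R ∩ {a₃ ∉ C₂}`. -/
lemma PD_eq_R_inter (ends : E → Sym2 V) (a₁ a₂ a₃ : V) :
    PDEvent ends a₁ a₂ a₃ = avoidAll ends a₁ {a₂, a₃} ∩ (connEvent ends a₂ a₃)ᶜ := by
  ext ω
  simp only [PDEvent, Dtilde, inU, Set.mem_inter_iff, Set.mem_compl_iff, Set.mem_union,
    mem_connEvent, not_or, avoidAll, Set.mem_setOf_eq, Finset.mem_insert, Finset.mem_singleton,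
    forall_eq_or_imp, forall_eq]
  have h13 : Conn ends ω a₁ a₃ ↔ Conn ends ω a₃ a₁ := ⟨conn_symm, conn_symm⟩
  have h23 : Conn ends ω a₂ a₃ ↔ Conn ends ω a₃ a₂ := ⟨conn_symm, conn_symm⟩
  tauto

omit [Fintype E] [DecidableEq E] [Fintype V] in
/-- `T = R ∩ {a₃ ∈ C₂}`. -/
lemma T_eq_R_inter (ends : E → Sym2 V) (a₁ a₂ a₃ : V) :
    TEvent ends a₁ a₂ a₃ = avoidAll ends a₁ {a₂, a₃} ∩ connEvent ends a₂ a₃ := by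
  ext ω
  simp only [TEvent, Set.mem_inter_iff, Set.mem_compl_iff, mem_connEvent, avoidAll,
    Set.mem_setOf_eq, Finset.mem_insert, Finset.mem_singleton, forall_eq_or_imp, forall_eq]
  have h12 : Conn ends ω a₂ a₁ ↔ Conn ends ω a₁ a₂ := ⟨conn_symm, conn_symm⟩
  have h13 : Conn ends ω a₁ a₃ → Conn ends ω a₂ a₃ → Conn ends ω a₁ a₂ :=
    fun h1 h2 => conn_trans h1 (conn_symm h2)
  tauto

omit [Fintype V] [LinearOrder R] [IsStrictOrderedRing R] in
/-- **`R = PD ⊔ T`** on any event `X`: `P(PD ∩ X) + P(T ∩ X) = P(R ∩ X)`. -/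
lemma prob_PD_add_T (p : E → R) (ends : E → Sym2 V) (a₁ a₂ a₃ : V) (X : Set (Config E)) :
    prob p (PDEvent ends a₁ a₂ a₃ ∩ X) + prob p (TEvent ends a₁ a₂ a₃ ∩ X) =
      prob p (avoidAll ends a₁ {a₂, a₃} ∩ X) := by
  have h := prob_inter_add_prob_inter_compl p (avoidAll ends a₁ {a₂, a₃} ∩ X) (connEvent ends a₂ a₃)
  rw [PD_eq_R_inter, T_eq_R_inter]
  have e1 : avoidAll ends a₁ {a₂, a₃} ∩ (connEvent ends a₂ a₃)ᶜ ∩ X =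
      avoidAll ends a₁ {a₂, a₃} ∩ X ∩ (connEvent ends a₂ a₃)ᶜ := by
    ext ω; simp only [Set.mem_inter_iff]; tauto
  have e2 : avoidAll ends a₁ {a₂, a₃} ∩ connEvent ends a₂ a₃ ∩ X =
      avoidAll ends a₁ {a₂, a₃} ∩ X ∩ connEvent ends a₂ a₃ := by
    ext ω; simp only [Set.mem_inter_iff]; tauto
  rw [e1, e2]
  linear_combination h

omit [Fintype V] [DecidableEq V] [LinearOrder R] [IsStrictOrderedRing R] in
/-- The `o`-location split of a sub-event `X ⊆ PD`:
`P(X) = P(X, oL) + P(X, oH) + P(X, out)`. -/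
lemma prob_oloc_split (p : E → R) (ends : E → Sym2 V) (o a₁ a₂ a₃ : V) (X : Set (Config E))
    (hX : X ⊆ PDEvent ends a₁ a₂ a₃) :
    prob p X = prob p (X ∩ connEvent ends a₁ o) + prob p (X ∩ connEvent ends a₂ o) +
      prob p (X ∩ (connEvent ends a₁ o)ᶜ ∩ (connEvent ends a₂ o)ᶜ) := by
  have s1 := prob_inter_add_prob_inter_compl p X (connEvent ends a₁ o)
  have s2 := prob_inter_add_prob_inter_compl p (X ∩ (connEvent ends a₁ o)ᶜ) (connEvent ends a₂ o)
  have e : X ∩ (connEvent ends a₁ o)ᶜ ∩ connEvent ends a₂ o = X ∩ connEvent ends a₂ o := by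
    ext ω
    simp only [Set.mem_inter_iff, Set.mem_compl_iff, mem_connEvent]
    constructor
    · rintro ⟨⟨hx, _⟩, h2⟩
      exact ⟨hx, h2⟩
    · rintro ⟨hx, h2⟩
      refine ⟨⟨hx, fun h1 => ?_⟩, h2⟩
      have hPD := hX hx
      simp only [PDEvent, Set.mem_inter_iff, Set.mem_compl_iff, mem_connEvent] at hPD
      exact hPD.1 (conn_trans h1 (conn_symm h2))
  rw [e] at s2
  linear_combination -s1 - s2

end Splits

section Identities

variable {V : Type*} {E : Type*} [Fintype E] [DecidableEq E] [Fintype V] [DecidableEq V]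
  {R : Type*} [Field R] [LinearOrder R] [IsStrictOrderedRing R]

omit [Fintype V] [DecidableEq V] [LinearOrder R] [IsStrictOrderedRing R] in
/-- `D = D_l + D_h + D_out`. -/
lemma D_split (p : E → R) (ends : E → Sym2 V) (o a₁ a₂ a₃ : V) :
    prob p (PDEvent ends a₁ a₂ a₃) =
      prob p (PDEvent ends a₁ a₂ a₃ ∩ connEvent ends a₁ o) +
        prob p (PDEvent ends a₁ a₂ a₃ ∩ connEvent ends a₂ o) + Dout p ends o a₁ a₂ a₃ :=
  prob_oloc_split p ends o a₁ a₂ a₃ _ subset_rfl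

omit [Fintype V] [DecidableEq V] [LinearOrder R] [IsStrictOrderedRing R] in
/-- `M_l = P(PD, bL, oL) + P(PD, bL, oH) + P(PD, bL, out)`. -/
lemma Ml_split (p : E → R) (ends : E → Sym2 V) (o a₁ a₂ a₃ b : V) :
    prob p (PDEvent ends a₁ a₂ a₃ ∩ connEvent ends a₁ b) =
      prob p (PDEvent ends a₁ a₂ a₃ ∩ connEvent ends a₁ o ∩ connEvent ends a₁ b) +
        prob p (PDEvent ends a₁ a₂ a₃ ∩ connEvent ends a₂ o ∩ connEvent ends a₁ b) +
        prob p (PDEvent ends a₁ a₂ a₃ ∩ (connEvent ends a₁ o)ᶜ ∩ (connEvent ends a₂ o)ᶜ ∩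
          connEvent ends a₁ b) := by
  have h := prob_oloc_split p ends o a₁ a₂ a₃ (PDEvent ends a₁ a₂ a₃ ∩ connEvent ends a₁ b)
    Set.inter_subset_left
  have e1 : PDEvent ends a₁ a₂ a₃ ∩ connEvent ends a₁ b ∩ connEvent ends a₁ o =
      PDEvent ends a₁ a₂ a₃ ∩ connEvent ends a₁ o ∩ connEvent ends a₁ b := by
    ext ω; simp only [Set.mem_inter_iff]; tauto
  have e2 : PDEvent ends a₁ a₂ a₃ ∩ connEvent ends a₁ b ∩ connEvent ends a₂ o =
      PDEvent ends a₁ a₂ a₃ ∩ connEvent ends a₂ o ∩ connEvent ends a₁ b := by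
    ext ω; simp only [Set.mem_inter_iff]; tauto
  have e3 : PDEvent ends a₁ a₂ a₃ ∩ connEvent ends a₁ b ∩ (connEvent ends a₁ o)ᶜ ∩
      (connEvent ends a₂ o)ᶜ =
      PDEvent ends a₁ a₂ a₃ ∩ (connEvent ends a₁ o)ᶜ ∩ (connEvent ends a₂ o)ᶜ ∩ connEvent ends a₁ b := by
    ext ω; simp only [Set.mem_inter_iff]; tauto
  rw [e1, e2, e3] at h
  exact h

omit [Fintype V] [LinearOrder R] [IsStrictOrderedRing R] in
/-- `W = M_R + M_l`. -/
lemma W_eq_MR_add_Ml (p : E → R) (ends : E → Sym2 V) (a₁ a₂ a₃ b : V) :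
    massM2 p ends a₁ a₂ a₃ b + deltaT p ends a₁ a₂ a₃ b =
      MR p ends a₁ a₂ a₃ b + prob p (PDEvent ends a₁ a₂ a₃ ∩ connEvent ends a₁ b) := by
  have hN := Nh_eq p ends a₁ a₂ a₃ b
  have hL := prob_PD_add_T p ends a₁ a₂ a₃ (connEvent ends a₁ b)
  have e1 : avoidAll ends a₁ {a₂, a₃} ∩ connEvent ends a₁ b =
      connEvent ends a₁ b ∩ avoidAll ends a₁ {a₂, a₃} := Set.inter_comm _ _
  have e2 : TEvent ends a₁ a₂ a₃ ∩ connEvent ends a₁ b = connEvent ends a₁ b ∩ TEvent ends a₁ a₂ a₃ :=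
    Set.inter_comm _ _
  rw [e1, e2] at hL
  unfold MR deltaT
  linear_combination -hN - hL

omit [Fintype V] [LinearOrder R] [IsStrictOrderedRing R] in
/-- `P(R, oL, bL) = P(PD, oL, bL) + P(T, oL, bL)`. -/
lemma prob_R_oL_bL (p : E → R) (ends : E → Sym2 V) (o a₁ a₂ a₃ b : V) :
    prob p (connEvent ends a₁ o ∩ connEvent ends a₁ b ∩ avoidAll ends a₁ {a₂, a₃}) =
      prob p (PDEvent ends a₁ a₂ a₃ ∩ connEvent ends a₁ o ∩ connEvent ends a₁ b) +
        prob p (TEvent ends a₁ a₂ a₃ ∩ connEvent ends a₁ o ∩ connEvent ends a₁ b) := by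
  have h := prob_PD_add_T p ends a₁ a₂ a₃ (connEvent ends a₁ o ∩ connEvent ends a₁ b)
  have e0 : avoidAll ends a₁ {a₂, a₃} ∩ (connEvent ends a₁ o ∩ connEvent ends a₁ b) =
      connEvent ends a₁ o ∩ connEvent ends a₁ b ∩ avoidAll ends a₁ {a₂, a₃} := by
    ext ω; simp only [Set.mem_inter_iff]; tauto
  have e1 : PDEvent ends a₁ a₂ a₃ ∩ (connEvent ends a₁ o ∩ connEvent ends a₁ b) =
      PDEvent ends a₁ a₂ a₃ ∩ connEvent ends a₁ o ∩ connEvent ends a₁ b := (Set.inter_assoc _ _ _).symm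
  have e2 : TEvent ends a₁ a₂ a₃ ∩ (connEvent ends a₁ o ∩ connEvent ends a₁ b) =
      TEvent ends a₁ a₂ a₃ ∩ connEvent ends a₁ o ∩ connEvent ends a₁ b := (Set.inter_assoc _ _ _).symm
  rw [e0, e1, e2] at h
  exact h.symm

omit [Fintype V] [DecidableEq V] [LinearOrder R] [IsStrictOrderedRing R] in
/-- `ASSOC = AL + AH`. -/
theorem ASSOC_eq (p : E → R) (ends : E → Sym2 V) (o a₁ a₂ a₃ b : V) :
    ASSOC p ends o a₁ a₂ a₃ b = AL p ends o a₁ a₂ a₃ b + AH p ends o a₁ a₂ a₃ b := by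
  unfold ASSOC AL AH
  rw [D_split p ends o a₁ a₂ a₃, Ml_split p ends o a₁ a₂ a₃ b]
  ring

omit [Fintype V] [LinearOrder R] [IsStrictOrderedRing R] in
/-- **`(Yu1Δ)-slack = MRl + D_l · M_l − D · P(PD, oL, bL)`** (ADDENDUM 17 (14)(b)). -/
theorem sigma_eq_MRl (p : E → R) (ends : E → Sym2 V) (o a₁ a₂ a₃ b : V) :
    prob p (PDEvent ends a₁ a₂ a₃ ∩ connEvent ends a₁ o) *
          (massM2 p ends a₁ a₂ a₃ b + deltaT p ends a₁ a₂ a₃ b) +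
        deltaL p ends o a₁ a₂ a₃ b * prob p (PDEvent ends a₁ a₂ a₃) -
      prob p (PDEvent ends a₁ a₂ a₃ ∩ connEvent ends a₁ o ∩ connEvent ends a₂ b) *
        prob p (PDEvent ends a₁ a₂ a₃) =
      MRl p ends o a₁ a₂ a₃ b +
        prob p (PDEvent ends a₁ a₂ a₃ ∩ connEvent ends a₁ o) *
          prob p (PDEvent ends a₁ a₂ a₃ ∩ connEvent ends a₁ b) -
        prob p (PDEvent ends a₁ a₂ a₃) *
          prob p (PDEvent ends a₁ a₂ a₃ ∩ connEvent ends a₁ o ∩ connEvent ends a₁ b) := by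
  have hW := W_eq_MR_add_Ml p ends a₁ a₂ a₃ b
  have hT := Tlh_sub_deltaL p ends o a₁ a₂ a₃ b
  have hR := prob_R_oL_bL p ends o a₁ a₂ a₃ b
  unfold MRl MRoL
  rw [hW]
  have e : TEvent ends a₁ a₂ a₃ ∩ connEvent ends a₁ o ∩ connEvent ends a₁ b =
      connEvent ends a₁ o ∩ connEvent ends a₁ b ∩ TEvent ends a₁ a₂ a₃ := by
    ext ω; simp only [Set.mem_inter_iff]; tauto
  rw [e] at hR
  linear_combination (-(prob p (PDEvent ends a₁ a₂ a₃))) * hT -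
    (prob p (PDEvent ends a₁ a₂ a₃)) * hR

omit [Fintype V] [LinearOrder R] [IsStrictOrderedRing R] in
/-- **`(I) = (Yu1Δ)-slack + LH`**. -/
theorem PieceI_eq (p : E → R) (ends : E → Sym2 V) (o a₁ a₂ a₃ b : V) :
    PieceI p ends o a₁ a₂ a₃ b =
      (prob p (PDEvent ends a₁ a₂ a₃ ∩ connEvent ends a₁ o) *
            (massM2 p ends a₁ a₂ a₃ b + deltaT p ends a₁ a₂ a₃ b) +
          deltaL p ends o a₁ a₂ a₃ b * prob p (PDEvent ends a₁ a₂ a₃) -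
        prob p (PDEvent ends a₁ a₂ a₃ ∩ connEvent ends a₁ o ∩ connEvent ends a₂ b) *
          prob p (PDEvent ends a₁ a₂ a₃)) + LH p ends o a₁ a₂ a₃ b := by
  rw [sigma_eq_MRl]
  unfold PieceI AL LH
  rw [D_split p ends o a₁ a₂ a₃, Ml_split p ends o a₁ a₂ a₃ b]
  ring

omit [Fintype V] [LinearOrder R] [IsStrictOrderedRing R] in
/-- **`Yh − LH = M_R · D_h − AH`** (the heavy piece). -/
theorem Yh_sub_LH_eq (p : E → R) (ends : E → Sym2 V) (o a₁ a₂ a₃ b : V) :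
    Yh p ends o a₁ a₂ a₃ b - LH p ends o a₁ a₂ a₃ b =
      MR p ends a₁ a₂ a₃ b * prob p (PDEvent ends a₁ a₂ a₃ ∩ connEvent ends a₂ o) -
        AH p ends o a₁ a₂ a₃ b := by
  unfold Yh LH AH
  rw [W_eq_MR_add_Ml p ends a₁ a₂ a₃ b, D_split p ends o a₁ a₂ a₃, Ml_split p ends o a₁ a₂ a₃ b]
  ring

omit [Fintype V] [LinearOrder R] [IsStrictOrderedRing R] in
/-- **`Z = (I) + (IIp)`** (ADDENDUM 17 (14)(b)). -/
theorem Z_eq_I_add_II (p : E → R) (ends : E → Sym2 V) (o a₁ a₂ a₃ b : V) :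
    (prob p (PDEvent ends a₁ a₂ a₃ ∩ connEvent ends a₁ o) +
          prob p (PDEvent ends a₁ a₂ a₃ ∩ connEvent ends a₂ o)) *
        (massM2 p ends a₁ a₂ a₃ b + deltaT p ends a₁ a₂ a₃ b) -
      ((prob p (PDEvent ends a₁ a₂ a₃ ∩ connEvent ends a₁ o ∩ connEvent ends a₂ b) -
            deltaL p ends o a₁ a₂ a₃ b) +
          (prob p (PDEvent ends a₁ a₂ a₃ ∩ connEvent ends a₂ o ∩ connEvent ends a₁ b) -
            deltaH p ends o a₁ a₂ a₃ b)) * prob p (PDEvent ends a₁ a₂ a₃) =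
      PieceI p ends o a₁ a₂ a₃ b + PieceII p ends o a₁ a₂ a₃ b := by
  rw [Z_eq_Z0h_add_deltaH, Z0Zh_eq_sigma_add_Yh, PieceI_eq]
  unfold PieceII PieceIIcore
  have h := Yh_sub_LH_eq p ends o a₁ a₂ a₃ b
  linear_combination h

omit [Fintype V] [LinearOrder R] [IsStrictOrderedRing R] in
/-- **`L2 = Z_0 + Z_h = MRshare − ASSOC`**. -/
theorem Z0Zh_eq_MRshare_sub_ASSOC (p : E → R) (ends : E → Sym2 V) (o a₁ a₂ a₃ b : V) :
    Z0 p ends o a₁ a₂ a₃ b + Zh p ends o a₁ a₂ a₃ b =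
      MRshare p ends o a₁ a₂ a₃ b - ASSOC p ends o a₁ a₂ a₃ b := by
  rw [Z0Zh_eq_sigma_add_Yh, sigma_eq_MRl, ASSOC_eq]
  unfold MRshare Yh AL AH
  rw [W_eq_MR_add_Ml p ends a₁ a₂ a₃ b, D_split p ends o a₁ a₂ a₃, Ml_split p ends o a₁ a₂ a₃ b]
  ring

omit [Fintype V] in
/-- `(ZΔ)` from the two pieces. -/
theorem ZDelta_of_pieces (p : E → R) (ends : E → Sym2 V) {o a₁ a₂ a₃ b : V}
    (h1 : PieceINonneg p ends o a₁ a₂ a₃ b) (h2 : PieceIINonneg p ends o a₁ a₂ a₃ b) :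
    ZDelta p ends o a₁ a₂ a₃ b := by
  unfold ZDelta
  have e := Z_eq_I_add_II p ends o a₁ a₂ a₃ b
  unfold PieceINonneg at h1
  unfold PieceIINonneg at h2
  linarith

end Identities

end ISplit

end Summit.Ventures.PercRepro2
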